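import Literature.MathematicalPhysics.QuantumLattice.HubbardModel
import Literature.MathematicalPhysics.QuantumLattice.PairCorrelations
import Literature.MathematicalPhysics.QuantumLattice.DWaveSource
import Summits.HubbardSuperconductivity.HubbardSuperconductivity.Theorems.BalabanIRBirEveryGroundStateSchur
import HarnessLib

/-!
# Route `AposterioriCapRg` — crux `SsbToEvenTorusLro` (stmt-HubbardSuperconductivity-1315),
# line `number-projected-canonical-slope`, stub `stub_facePurityOfSlope`

Sorry-free. On the even torus of side `L = 2k + 2`, in the `(N_L, S^z = 0)` sector
(`N_L = 2⌊(1 - δ)L²/2⌋`), write `E(κ)` for the sector energy of the block-sourced Hamiltonian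
`hubbardTorus 2 L 1 U + κ W_R` (`W_R = R⁻⁴ Σ_x B_xᴴ B_x`, `B_x` the `R × R` block sum of local
`d`-wave pairs at `x`), `E₀ = E(0)` and `m = dWaveOrderParameter U μ`.

* `stub_facePurityOfSlope` — the canonical attractive SLOPE
  (`E(κ) − E₀ ≤ κ(m² − ε)L²` eventually, every `κ < 0`, `ε > 0`) and the iso-density no-kink (X)
  (`E(κ) + E(−κ) − 2E₀ ≥ −εκL²` eventually, for some `κ > 0`, every `ε > 0`) give SHARP face
  purity of EVERY normalised sector ground state `ψ`: `(m² − ε)L² ≤ Re⟨ψ, W_R ψ⟩` eventually.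

Proof (`face_of_noKink_of_slope`, pure bookkeeping): (X) at `ε/2` gives `κ > 0` with
`E(κ) + E(−κ) − 2E₀ ≥ −(ε/2)κL²`; SLOPE at `−κ`, `ε/2` gives `E(−κ) − E₀ ≤ −κ(m² − ε/2)L²`;
subtracting, `E(κ) − E₀ ≥ κ(m² − ε)L²`; the per-eigenvector chord inequality
`E(κ) − E₀ ≤ κ Re⟨ψ, W_R ψ⟩` (`chord_div_le_re_expect_of_eigen`, one variational step,
Tasaki (2020) §2.1) and `κ > 0` conclude. Folklore; no definition is introduced. [folklore]
-/

noncomputable section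

namespace Summit.HubbardSuperconductivity.HubbardSuperconductivity.Theorems

set_option linter.dupNamespace false

open Literature.MathematicalPhysics.QuantumLattice Literature.Probability.LatticeModels Matrix
open Filter Set
open scoped Matrix ComplexOrder ComplexConjugate Matrix.Norms.L2Operator

/-- **No-kink + attractive slope ⇒ face purity, abstract form.** For matrices `H`, `W`, a sector `K`,
`κ > 0` and reals `m`, `ε`, `L2`: if `E(κ) + E(−κ) − 2E₀ ≥ −(ε/2 · κ)L2` (no kink) and
`E(−κ) − E₀ ≤ (−κ)(m² − ε/2)L2` (slope at `−κ`), where `E(κ) = minEnergyOn (H + κW) K`,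
`E₀ = minEnergyOn H K`, then every unit eigenvector `ψ ∈ K` of `H` with eigenvalue `E₀` has
`(m² − ε)L2 ≤ Re⟨ψ, Wψ⟩` (chord inequality `E(κ) − E₀ ≤ κ Re⟨ψ, Wψ⟩`, then divide by `κ`).
Tasaki (2020) §2.1. [folklore] -/
theorem face_of_noKink_of_slope {n : Type*} [Fintype n] (H W : Matrix n n ℂ)
    (K : Submodule ℂ (n → ℂ)) {κ m ε L2 : ℝ} (hκ : 0 < κ)
    (hX : -(ε / 2 * κ) * L2 ≤
      (H + (κ : ℂ) • W).minEnergyOn K + (H + ((-κ : ℝ) : ℂ) • W).minEnergyOn K -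
        2 * H.minEnergyOn K)
    (hS : (H + ((-κ : ℝ) : ℂ) • W).minEnergyOn K - H.minEnergyOn K ≤
      (-κ) * (m ^ 2 - ε / 2) * L2)
    {ψ : n → ℂ} (hψK : ψ ∈ K) (hψ : star ψ ⬝ᵥ ψ = 1)
    (heig : H *ᵥ ψ = ((H.minEnergyOn K : ℝ) : ℂ) • ψ) :
    (m ^ 2 - ε) * L2 ≤ (star ψ ⬝ᵥ W *ᵥ ψ).re := by
  have hchord := chord_div_le_re_expect_of_eigen H W K hκ hψK hψ heig
  rw [div_le_iff₀ hκ] at hchord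
  have h1 : κ * ((m ^ 2 - ε) * L2) ≤ κ * (star ψ ⬝ᵥ W *ᵥ ψ).re := by linarith
  exact le_of_mul_le_mul_left h1 hκ

/-- **(FACE) stub_facePurityOfSlope** — SLOPE at `(U, δ, μ)` + the iso-density no-kink (X) at `(U, δ)` ⇒ SHARP face purity
of EVERY `(N_L, S^z = 0)`-sector ground state: `(m² − ε)L² ≤ Re⟨ψ, W_R ψ⟩` eventually along even sides, for every `R ≥ 1`
and `ε > 0`. Proof: (X) at `ε/2` gives `κ > 0` with `E_sec(κW_R) + E_sec(−κW_R) − 2E_sec(0) ≥ −(εκ/2)L²`; SLOPE at `−κ`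
gives `E_sec(−κW_R) − E_sec(0) ≤ −κ(m² − ε/2)L²`; so `E_sec(κW_R) − E_sec(0) ≥ κ(m² − ε)L²`, and the per-eigenvector
chord `E_sec(H + κW_R) − E_sec(H) ≤ κ·Re⟨ψ, W_Rψ⟩` (`chord_div_le_re_expect_of_eigen`) concludes. Tasaki (2020) §2.1. [folklore] -/
theorem stub_facePurityOfSlope :
    ∀ (U δ μ : ℝ),
      (∀ R : ℕ, 0 < R → ∀ κ : ℝ, κ < 0 → ∀ ε : ℝ, 0 < ε → ∀ᶠ k : ℕ in Filter.atTop,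
        (hubbardTorus 2 (2 * k + 1 + 1) 1 U + (κ : ℂ) • (((((R : ℝ) ^ 4)⁻¹ : ℝ) : ℂ) • ∑ a : TorusSite 2 (2 * k + 1 + 1), (∑ u : Fin 2 → Fin R, localPair dWaveFormFactor (2 * k + 1 + 1) (a + fun i => ((u i : ℕ) : ZMod (2 * k + 1 + 1))))ᴴ * (∑ u : Fin 2 → Fin R, localPair dWaveFormFactor (2 * k + 1 + 1) (a + fun i => ((u i : ℕ) : ZMod (2 * k + 1 + 1)))))).minEnergyOn (szSector (2 * ⌊(1 - δ) * ((2 * k + 1 + 1 : ℕ) : ℝ) ^ 2 / 2⌋₊) 0) -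
            (hubbardTorus 2 (2 * k + 1 + 1) 1 U).minEnergyOn (szSector (2 * ⌊(1 - δ) * ((2 * k + 1 + 1 : ℕ) : ℝ) ^ 2 / 2⌋₊) 0) ≤
          κ * (dWaveOrderParameter U μ ^ 2 - ε) * ((2 * k + 1 + 1 : ℕ) : ℝ) ^ 2) →
      (∀ R : ℕ, 0 < R → ∀ ε : ℝ, 0 < ε → ∃ κ : ℝ, 0 < κ ∧ ∀ᶠ k : ℕ in Filter.atTop,
        -(ε * κ) * ((2 * k + 1 + 1 : ℕ) : ℝ) ^ 2 ≤
          (hubbardTorus 2 (2 * k + 1 + 1) 1 U + (κ : ℂ) • (((((R : ℝ) ^ 4)⁻¹ : ℝ) : ℂ) • ∑ a : TorusSite 2 (2 * k + 1 + 1), (∑ u : Fin 2 → Fin R, localPair dWaveFormFactor (2 * k + 1 + 1) (a + fun i => ((u i : ℕ) : ZMod (2 * k + 1 + 1))))ᴴ * (∑ u : Fin 2 → Fin R, localPair dWaveFormFactor (2 * k + 1 + 1) (a + fun i => ((u i : ℕ) : ZMod (2 * k + 1 + 1)))))).minEnergyOn (szSector (2 * ⌊(1 - δ) * ((2 * k +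 1 + 1 : ℕ) : ℝ) ^ 2 / 2⌋₊) 0) +
          (hubbardTorus 2 (2 * k + 1 + 1) 1 U + ((-κ : ℝ) : ℂ) • (((((R : ℝ) ^ 4)⁻¹ : ℝ) : ℂ) • ∑ a : TorusSite 2 (2 * k + 1 + 1), (∑ u : Fin 2 → Fin R, localPair dWaveFormFactor (2 * k + 1 + 1) (a + fun i => ((u i : ℕ) : ZMod (2 * k + 1 + 1))))ᴴ * (∑ u : Fin 2 → Fin R, localPair dWaveFormFactor (2 * k + 1 + 1) (a + fun i => ((u i : ℕ) : ZMod (2 * k + 1 + 1)))))).minEnergyOn (szSector (2 * ⌊(1 - δ) * ((2 * k + 1 + 1 : ℕ) : ℝ) ^ 2 / 2⌋₊) 0) -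
          2 * (hubbardTorus 2 (2 * k + 1 + 1) 1 U).minEnergyOn (szSector (2 * ⌊(1 - δ) * ((2 * k + 1 + 1 : ℕ) : ℝ) ^ 2 / 2⌋₊) 0)) →
      ∀ R : ℕ, 0 < R → ∀ ε : ℝ, 0 < ε → ∀ᶠ k : ℕ in Filter.atTop,
        ∀ ψ : Fock (Orb (FermionTorus 2 (2 * k + 1 + 1))),
          IsGroundStateInSector (hubbardTorus 2 (2 * k + 1 + 1) 1 U) (2 * ⌊(1 - δ) * ((2 * k + 1 + 1 : ℕ) : ℝ) ^ 2 / 2⌋₊) 0 ψ →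
          star ψ ⬝ᵥ ψ = 1 →
          (dWaveOrderParameter U μ ^ 2 - ε) * ((2 * k + 1 + 1 : ℕ) : ℝ) ^ 2 ≤
            (star ψ ⬝ᵥ ((((((R : ℝ) ^ 4)⁻¹ : ℝ) : ℂ) • ∑ x : TorusSite 2 (2 * k + 1 + 1), (∑ u : Fin 2 → Fin R, localPair dWaveFormFactor (2 * k + 1 + 1) (x + fun i => ((u i : ℕ) : ZMod (2 * k + 1 + 1))))ᴴ * (∑ u : Fin 2 → Fin R, localPair dWaveFormFactor (2 * k + 1 + 1) (x + fun i => ((u i : ℕ) : ZMod (2 * k + 1 + 1))))) *ᵥ ψ)).re := by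
  intro U δ μ hSlope hX R hR ε hε
  obtain ⟨κ, hκ, hXev⟩ := hX R hR (ε / 2) (half_pos hε)
  have hSev := hSlope R hR (-κ) (neg_neg_of_pos hκ) (ε / 2) (half_pos hε)
  filter_upwards [hXev, hSev] with k hXk hSk ψ hGS hψ1
  exact face_of_noKink_of_slope _ _ _ hκ hXk hSk hGS.1 hψ1 hGS.2.2

end Summit.HubbardSuperconductivity.HubbardSuperconductivity.Theorems

end
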